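import Mathlib
import Summits.Parity.BatemanHorn.Theses.PolynomialMobius
import Summits.Parity.BatemanHorn.Theorems.PolynomialMobiusPolyMobiusTailWindowLinearPair
import Summits.Parity.BatemanHorn.Theorems.PolynomialMobiusPolyMobiusTailCoreLocalisation
import Summits.Parity.BatemanHorn.Theorems.PolyMobiusTail.Negative.Equivalence
import Summits.Parity.BatemanHorn.Theorems.IsogenyRedeiTypeIMainTerm
import Summits.Parity.BatemanHorn.Theorems.IsogenyRedeiLambdaToCount
import Literature.NumberTheory.Sieve.AletheiaZomleferFukshanskyGarcia2020Applications
import Literature.NumberTheory.Sieve.SingularSeriesProofs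

/-!
# Crux `PolyMobiusTail` (stmt-Parity-0870), registered skeleton `Lines/stub_large.lean`:
# STRENGTH CERTIFICATE for the registered stub `stub_large_core` (S4a, the parity core)

The line `eta-free-multilinear-window` (skeleton v5 = `Cruxes/PolyMobiusTail/Lines/stub_large.lean`)
concludes the crux from four registered stubs; three leads (c3, c5, c6) ended `promote-stub
stub_large_core`, citing "crux-sized BY THEOREM (p155041 + p148167 + p138374)".  This file makes that
verdict ONE kernel-checked statement, with no Bateman–Horn axiom anywhere:

* `window_linear_pair_uniform` — the landed linear PAIR window (p146909 corner, p148016 middle,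
  p145202 balanced) in its natural UNIFORM form: for every Bateman–Horn pair of degree-`≤ 1` members
  there is `c = c(f) ∈ (0,1)` such that the window `(x^{1-η}, x^{1+θ}]` of the Möbius tail is `o(x)` for
  ALL `θ, η ∈ (0, c]` (the registered `stub_window_linear_pair`, p148167, records only `θ = η = c`).
* `lambda_isEquivalent_of_tail` / `tail_of_lambda_isEquivalent` — the slice-wise, now UNCONDITIONAL
  (`typeIMainTerm_proof`, stmt-Parity-0873) form of `Negative.Equivalence.polyMobiusTail_iff_lambdaBatemanHorn`:
  for ONE Bateman–Horn system, the crux's tail conclusion at any `η ∈ (0,1)` is equivalent to the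
  `Λ`-Bateman–Horn asymptotic `∑_{n≤x} ∏ Λ(fᵢ(n)) ∼ C(f)·x`.
* `core_iff_lambda_pair` — **exact strength of S4a on a linear pair**: for every Bateman–Horn pair `f`
  of degree-`≤ 1` members there is `c ∈ (0,1)` such that for ALL `0 < θ ≤ c` and `δ < θ` the conclusion of
  `stub_large_core` for `f` at `(θ, δ)` is EQUIVALENT to the `Λ`-Hardy–Littlewood asymptotic for `f`.
  (For `θ > c(f)` the stub asserts more — Möbius–Hardy–Littlewood sums along pencils of length `x^{θ}`
  with level `x^{1-δ}` — which Hardy–Littlewood for `f` alone does not give back; so the registered `∀ θ`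
  form is AT LEAST crux-strength on pairs, and exactly crux-strength for `θ ≤ c(f)`.)
* `batemanHornAsymptotic_of_core_pair` — S4a for ONE linear pair proves Bateman–Horn (count form,
  via `lambdaToCount_proof`, stmt-Parity-0874) for that pair: Hardy–Littlewood for every admissible pair
  of linear forms (`hardyLittlewoodPairs_of_stub_large_core`).
* `twinPrimeCount_isEquivalent_of_core_twin`, `twinPrimeConjecture_of_core_twin`,
  `twinPrimeConjecture_of_stub_large_core` — **the registered stub `stub_large_core`, already for the
  single system `(X, X + 2)`, proves `π₂(x) ∼ 2C₂·x/(log x)²` and the twin prime conjecture**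
  (`Literature.NumberTheory.Sieve.TwinPrimeConjecture`).

Consequently no input of Type-I/Type-II kind at any level settles S4a
(`Literature.Barriers.Parity.SelbergParityBarrier`, `FordFixedLevelBarrier`,
`Literature.NumberTheory.Sieve.bombieri_asymptotic_sieve_indeterminacy`): promoting it is promoting the
Hardy–Littlewood / Bateman–Horn parity core itself, in cofactor-Möbius form.  Pure composition of landed
theorems; axioms `propext`, `Classical.choice`, `Quot.sound` only.
-/

open scoped BigOperators Topology
open Filter Finset Polynomial Asymptotics ArithmeticFunction

namespace Summit.Parity.BatemanHorn.Theorems.PolyMobiusTail.EtaFreeWindow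

open Literature.NumberTheory.Sieve
open Summit.Parity.BatemanHorn.Theorems (typeIMainTerm_proof)
open Summit.Parity.BatemanHorn.LambdaToCount (lambdaToCount_proof)
open Summit.Parity.BatemanHorn.Theorems.PolyMobiusTail.Negative
  (sum_prod_vonMangoldt_eq_typeI_add_tail tail_isLittleO_of_isEquivalent)

namespace CoreStrength

/-! ### The pair window, uniform in `(θ, η)` -/

/-- **The linear PAIR window, uniformly in the cut-offs.** For a Bateman–Horn system of two members
of degree `≤ 1` there is `c ∈ (0,1)` such that for ALL `θ, η ∈ (0, c]` the window
`Σ_{n≤x} Σ_{dᵢ∣fᵢ(n), x^{1−η} < d₀d₁ ≤ x^{1+θ}} μ(d₀)log d₀ μ(d₁)log d₁` is `o(x)`.  Same assembly as the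
registered `stub_window_linear_pair` (p148167) — corner `min ≤ x^{3/10}` (`stub_pair_corner`), middle
`x^{3/10} < min ≤ x^{12/25}` (`stub_pair_middle`), balanced `x^{12/25} < min` (`stub_pair_balanced`),
`c = min(c₁, c₂, c₃, 1/2)` — keeping the uniformity the three range theorems already provide. [folklore] -/
theorem window_linear_pair_uniform : ∀ (f : Fin 2 → ℤ[X]), IsBatemanHornSystem f →
    (∀ i, (f i).natDegree ≤ 1) →
    ∃ c : ℝ, 0 < c ∧ c < 1 ∧ ∀ θ η : ℝ, 0 < θ → θ ≤ c → 0 < η → η ≤ c →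
      (fun x : ℕ => ∑ n ∈ Finset.Icc 1 x,
        ∑ d ∈ Fintype.piFinset (fun i => (((f i).eval (n : ℤ)).toNat).divisors),
          if (x : ℝ) ^ (1 - η) < ∏ i, (d i : ℝ) ∧ ∏ i, (d i : ℝ) ≤ (x : ℝ) ^ (1 + θ) then
            ∏ i, ((ArithmeticFunction.moebius (d i) : ℝ) * Real.log (d i)) else 0)
        =o[atTop] fun x : ℕ => (x : ℝ) := by
  intro f hf hlin
  obtain ⟨c₁, hc₁, h₁⟩ := stub_pair_corner f hf hlin (3 / 10) (by norm_num) (by norm_num)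
  obtain ⟨c₂, hc₂, h₂⟩ :=
    stub_pair_middle f hf hlin (3 / 10) (12 / 25) (by norm_num) (by norm_num) (by norm_num)
  obtain ⟨c₃, hc₃, h₃⟩ := stub_pair_balanced f hf hlin (12 / 25) (by norm_num) (by norm_num)
  set c : ℝ := min (min c₁ c₂) (min c₃ (1 / 2)) with hc_def
  have hc0 : 0 < c := lt_min (lt_min hc₁ hc₂) (lt_min hc₃ (by norm_num))
  have hcc₁ : c ≤ c₁ := (min_le_left _ _).trans (min_le_left _ _)
  have hcc₂ : c ≤ c₂ := (min_le_left _ _).trans (min_le_right _ _)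
  have hcc₃ : c ≤ c₃ := (min_le_right _ _).trans (min_le_left _ _)
  have hc1 : c < 1 := lt_of_le_of_lt ((min_le_right _ _).trans (min_le_right _ _)) (by norm_num)
  refine ⟨c, hc0, hc1, fun θ η hθ hθc hη hηc => ?_⟩
  have H := ((h₁ θ η hθ (hθc.trans hcc₁) hη (hηc.trans hcc₁)).add
    (h₂ θ η hθ (hθc.trans hcc₂) hη (hηc.trans hcc₂))).add (h₃ θ η hθ (hθc.trans hcc₃) hη (hηc.trans hcc₃))
  refine H.congr_left fun x => ?_
  rw [← Finset.sum_add_distrib, ← Finset.sum_add_distrib]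
  refine Finset.sum_congr rfl fun n hn => ?_
  rw [← Finset.sum_add_distrib, ← Finset.sum_add_distrib]
  refine Finset.sum_congr rfl fun d _ => ?_
  have hx1 : (1 : ℝ) ≤ (x : ℝ) := by
    have h := Finset.mem_Icc.mp hn
    exact_mod_cast h.1.trans h.2
  exact (pair_summand_split hx1 ((x : ℝ) ^ (1 - η) < ∏ i, (d i : ℝ))
    (∏ i, (d i : ℝ) ≤ (x : ℝ) ^ (1 + θ)) (min (d 0) (d 1))
    (∏ i, ((ArithmeticFunction.moebius (d i) : ℝ) * Real.log (d i)))).symm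

/-! ### Slice-wise, unconditional `tail ⟺ Λ-Bateman–Horn` -/

/-- **Tail `o(x)` at one `η` gives the `Λ`-Bateman–Horn asymptotic for that system** (unconditional:
the Type-I main term is the tree theorem `typeIMainTerm_proof`, stmt-Parity-0873).  For a Bateman–Horn
system `f` and `η ∈ (0,1)` with `Tail_η = o(x)`: `∑_{n≤x} ∏ Λ(fᵢ(n)) ∼ C(f)·x` with `C(f) > 0` the
Bateman–Horn constant (`∑ ∏ Λ = (-1)^k (TypeI_η + Tail_η)`, `(-1)^k TypeI_η ∼ C x`). [folklore] -/
theorem lambda_isEquivalent_of_tail {k : ℕ} {f : Fin k → ℤ[X]} (hf : IsBatemanHornSystem f)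
    {η : ℝ} (hη0 : 0 < η) (hη1 : η < 1)
    (hT : (fun x : ℕ => ∑ n ∈ Finset.Icc 1 x,
        ∑ d ∈ Fintype.piFinset (fun i => (((f i).eval (n : ℤ)).toNat).divisors),
          if (x : ℝ) ^ (1 - η) < ∏ i, (d i : ℝ) then
            ∏ i, ((ArithmeticFunction.moebius (d i) : ℝ) * Real.log (d i)) else 0)
      =o[atTop] fun x : ℕ => (x : ℝ)) :
    ∃ C : ℝ, 0 < C ∧ HasBatemanHornConst f C ∧
      (fun x : ℕ => ∑ n ∈ Finset.Icc 1 x, ∏ i, vonMangoldt (((f i).eval (n : ℤ)).toNat))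
        ~[atTop] (fun x : ℕ => C * (x : ℝ)) := by
  obtain ⟨C, hC, hHas, hM⟩ := typeIMainTerm_proof k f hf η hη0 hη1
  refine ⟨C, hC, hHas, ?_⟩
  have hB := (hT.const_mul_left ((-1 : ℝ) ^ k)).trans_isBigO
    (isBigO_self_const_mul hC.ne' (fun x : ℕ => (x : ℝ)) atTop)
  refine (hM.add_isLittleO hB).congr_left (Eventually.of_forall fun x => ?_)
  simp only [Pi.add_apply]
  rw [sum_prod_vonMangoldt_eq_typeI_add_tail f η x, mul_add]

/-- **The `Λ`-Bateman–Horn asymptotic for one system gives its tail `o(x)` at EVERY `η ∈ (0,1)`**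
(unconditional; the two constants agree by uniqueness of the ordered Euler-product limit, then
subtract two `∼ C x` asymptotics, `Negative.Equivalence.tail_isLittleO_of_isEquivalent`). [folklore] -/
theorem tail_of_lambda_isEquivalent {k : ℕ} {f : Fin k → ℤ[X]} (hf : IsBatemanHornSystem f) {C : ℝ}
    (hHas : HasBatemanHornConst f C)
    (hL : (fun x : ℕ => ∑ n ∈ Finset.Icc 1 x, ∏ i, vonMangoldt (((f i).eval (n : ℤ)).toNat))
      ~[atTop] (fun x : ℕ => C * (x : ℝ)))
    {η : ℝ} (hη0 : 0 < η) (hη1 : η < 1) :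
    (fun x : ℕ => ∑ n ∈ Finset.Icc 1 x,
        ∑ d ∈ Fintype.piFinset (fun i => (((f i).eval (n : ℤ)).toNat).divisors),
          if (x : ℝ) ^ (1 - η) < ∏ i, (d i : ℝ) then
            ∏ i, ((ArithmeticFunction.moebius (d i) : ℝ) * Real.log (d i)) else 0)
      =o[atTop] fun x : ℕ => (x : ℝ) := by
  obtain ⟨C', -, hHas', hM⟩ := typeIMainTerm_proof k f hf η hη0 hη1
  have hCC : C' = C := tendsto_nhds_unique hHas' hHas
  subst hCC
  exact tail_isLittleO_of_isEquivalent f hL hM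

/-! ### Exact strength of the core on a linear pair -/

/-- Total degree of a pair of degree-`≤ 1` members is `≤ 2`. [folklore] -/
theorem sum_natDegree_le_two_of_pair {f : Fin 2 → ℤ[X]} (hlin : ∀ i, (f i).natDegree ≤ 1) :
    ∑ i, (f i).natDegree ≤ 2 := by
  rw [Fin.sum_univ_two]
  have h0 := hlin 0
  have h1 := hlin 1
  omega

/-- **EXACT STRENGTH of `stub_large_core` (S4a) on a linear pair.**  For every Bateman–Horn system
`f = (f₀, f₁)` of degree-`≤ 1` members there is `c = c(f) ∈ (0,1)` such that for ALL `0 < θ ≤ c` and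
`δ < θ`: the conclusion of the registered stub `stub_large_core` for `f` at `(θ, δ)` — the cofactor
large part of the Möbius tail on complete pencils,
`Σ_{n≤x} Σ_{eᵢ∣fᵢ(n), ∏ fᵢ(n)/eᵢ > x^{1+θ}, ∏ eᵢ ≤ x^{1-δ}} ∏ μ(fᵢ(n)/eᵢ) log(fᵢ(n)/eᵢ) = o(x)` — holds
IF AND ONLY IF the `Λ`-Hardy–Littlewood asymptotic `∑_{n≤x} Λ(f₀(n))Λ(f₁(n)) ∼ C(f)·x` holds.
Composition of `window_linear_pair_uniform` (window at `(θ, θ)`), the landed localisation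
`stub_core_iff_tail_of_window_le_two` (p155041; band empty for total degree `≤ 2`, p154483; p138374)
and the slice-wise `tail ⟺ Λ` lemmas above.  No Bateman–Horn axiom. [folklore] -/
theorem core_iff_lambda_pair : ∀ (f : Fin 2 → ℤ[X]), IsBatemanHornSystem f →
    (∀ i, (f i).natDegree ≤ 1) →
    ∃ c : ℝ, 0 < c ∧ c < 1 ∧ ∀ θ δ : ℝ, 0 < θ → θ ≤ c → δ < θ →
      (((fun x : ℕ => ∑ n ∈ Finset.Icc 1 x,
          ∑ e ∈ Fintype.piFinset (fun i => (((f i).eval (n : ℤ)).toNat).divisors),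
            if (x : ℝ) ^ (1 + θ) < ∏ i, ((((f i).eval (n : ℤ)).toNat / e i : ℕ) : ℝ) ∧
                ∏ i, (e i : ℝ) ≤ (x : ℝ) ^ (1 - δ) then
              ∏ i, ((ArithmeticFunction.moebius (((f i).eval (n : ℤ)).toNat / e i) : ℝ) *
                Real.log ((((f i).eval (n : ℤ)).toNat / e i : ℕ) : ℝ)) else 0)
        =o[atTop] fun x : ℕ => (x : ℝ)) ↔
      ∃ C : ℝ, 0 < C ∧ HasBatemanHornConst f C ∧
        (fun x : ℕ => ∑ n ∈ Finset.Icc 1 x, ∏ i, vonMangoldt (((f i).eval (n : ℤ)).toNat))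
          ~[atTop] (fun x : ℕ => C * (x : ℝ))) := by
  intro f hf hlin
  obtain ⟨c, hc0, hc1, hW⟩ := window_linear_pair_uniform f hf hlin
  refine ⟨c, hc0, hc1, fun θ δ hθ hθc hδ => ?_⟩
  have hθ1 : θ < 1 := lt_of_le_of_lt hθc hc1
  rw [stub_core_iff_tail_of_window_le_two 2 f θ θ δ (sum_natDegree_le_two_of_pair hlin) hθ hθ.le hδ
    (hW θ θ hθ hθc hθ hθc)]
  constructor
  · exact lambda_isEquivalent_of_tail hf hθ hθ1
  · rintro ⟨C, -, hHas, hL⟩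
    exact tail_of_lambda_isEquivalent hf hHas hL hθ hθ1

/-- **S4a for ONE linear pair proves Bateman–Horn for that pair** (count form
`Literature.NumberTheory.Sieve.BatemanHornAsymptotic f`: `#{n ≤ x : f₀(n), f₁(n) prime} ∼ C(f)·x/(log x)²`),
via `core_iff_lambda_pair` at `(θ, δ) = (c, c/2)` and the tree theorem `lambdaToCount_proof`
(stmt-Parity-0874).  The hypothesis is VERBATIM the conclusion of the registered stub `stub_large_core`
specialised to `f`. [folklore] -/
theorem batemanHornAsymptotic_of_core_pair (f : Fin 2 → ℤ[X]) (hf : IsBatemanHornSystem f)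
    (hlin : ∀ i, (f i).natDegree ≤ 1)
    (hCore : ∀ θ δ : ℝ, 0 < θ → θ < 1 → 0 < δ → δ < θ →
      (fun x : ℕ => ∑ n ∈ Finset.Icc 1 x,
        ∑ e ∈ Fintype.piFinset (fun i => (((f i).eval (n : ℤ)).toNat).divisors),
          if (x : ℝ) ^ (1 + θ) < ∏ i, ((((f i).eval (n : ℤ)).toNat / e i : ℕ) : ℝ) ∧
              ∏ i, (e i : ℝ) ≤ (x : ℝ) ^ (1 - δ) then
            ∏ i, ((ArithmeticFunction.moebius (((f i).eval (n : ℤ)).toNat / e i) : ℝ) *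
              Real.log ((((f i).eval (n : ℤ)).toNat / e i : ℕ) : ℝ)) else 0)
        =o[atTop] fun x : ℕ => (x : ℝ)) :
    BatemanHornAsymptotic f := by
  obtain ⟨c, hc0, hc1, h⟩ := core_iff_lambda_pair f hf hlin
  obtain ⟨C, hC, hHas, hL⟩ := (h c (c / 2) hc0 le_rfl (by linarith)).mp
    (hCore c (c / 2) hc0 hc1 (by linarith) (by linarith))
  exact lambdaToCount_proof 2 f hf C hC hHas hL

/-- **`stub_large_core` ⇒ Hardy–Littlewood for every admissible PAIR of linear forms** (twin primes
`(X, X+2)`, Sophie Germain `(X, 2X+1)`, `(q₀X+a₀, q₁X+a₁)`, …): the registered stub (hypothesis, verbatim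
its registered signature) gives `BatemanHornAsymptotic f` for every Bateman–Horn system of two members of
degree `≤ 1`. [folklore] -/
theorem hardyLittlewoodPairs_of_stub_large_core
    (hS4a : ∀ (k : ℕ) (f : Fin k → ℤ[X]), IsBatemanHornSystem f → ∀ θ δ : ℝ,
      0 < θ → θ < 1 → 0 < δ → δ < θ →
      (fun x : ℕ => ∑ n ∈ Finset.Icc 1 x,
        ∑ e ∈ Fintype.piFinset (fun i => (((f i).eval (n : ℤ)).toNat).divisors),
          if (x : ℝ) ^ (1 + θ) < ∏ i, ((((f i).eval (n : ℤ)).toNat / e i : ℕ) : ℝ) ∧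
              ∏ i, (e i : ℝ) ≤ (x : ℝ) ^ (1 - δ) then
            ∏ i, ((ArithmeticFunction.moebius (((f i).eval (n : ℤ)).toNat / e i) : ℝ) *
              Real.log ((((f i).eval (n : ℤ)).toNat / e i : ℕ) : ℝ)) else 0)
        =o[atTop] fun x : ℕ => (x : ℝ)) :
    ∀ (f : Fin 2 → ℤ[X]), IsBatemanHornSystem f → (∀ i, (f i).natDegree ≤ 1) →
      BatemanHornAsymptotic f :=
  fun f hf hlin => batemanHornAsymptotic_of_core_pair f hf hlin (hS4a 2 f hf)

/-! ### The twin system `(X, X + 2)` -/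

/-- The twin system has members of degree `≤ 1`. [folklore] -/
theorem natDegree_twinSystem_le_one : ∀ i, (twinSystem i).natDegree ≤ 1 := by
  intro i
  fin_cases i
  · simp [twinSystem]
  · show ((X : ℤ[X]) + 2).natDegree ≤ 1
    have h : ((X : ℤ[X]) + 2).natDegree = 1 := by simpa using natDegree_X_add_C (2 : ℤ)
    omega

/-- **S4a for the single system `(X, X + 2)` proves the Hardy–Littlewood twin-prime asymptotic**
`π₂(x) ∼ 2C₂·x/(log x)²` (`C₂ = twinPrimeConst`; the Bateman–Horn constant of `(X, X+2)` is `2C₂` by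
the tree theorem `tendsto_twinPrimeConstPartial_holds`, and `Q(X, X+2; x) = π₂(x)`,
`polyPrimeCount_twinSystem`).  The hypothesis is VERBATIM the conclusion of the registered stub
`stub_large_core` at `k = 2`, `f = twinSystem`. [folklore] -/
theorem twinPrimeCount_isEquivalent_of_core_twin
    (hCore : ∀ θ δ : ℝ, 0 < θ → θ < 1 → 0 < δ → δ < θ →
      (fun x : ℕ => ∑ n ∈ Finset.Icc 1 x,
        ∑ e ∈ Fintype.piFinset (fun i => (((twinSystem i).eval (n : ℤ)).toNat).divisors),
          if (x : ℝ) ^ (1 + θ) < ∏ i, ((((twinSystem i).eval (n : ℤ)).toNat / e i : ℕ) : ℝ) ∧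
              ∏ i, (e i : ℝ) ≤ (x : ℝ) ^ (1 - δ) then
            ∏ i, ((ArithmeticFunction.moebius (((twinSystem i).eval (n : ℤ)).toNat / e i) : ℝ) *
              Real.log ((((twinSystem i).eval (n : ℤ)).toNat / e i : ℕ) : ℝ)) else 0)
        =o[atTop] fun x : ℕ => (x : ℝ)) :
    (fun x : ℕ => (twinPrimeCount x : ℝ)) ~[atTop]
      fun x : ℕ => 2 * twinPrimeConst * x / Real.log x ^ 2 := by
  obtain ⟨C, hC, hQ⟩ := batemanHornAsymptotic_of_core_pair twinSystem isBatemanHornSystem_twinSystem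
    natDegree_twinSystem_le_one hCore
  have hCeq : C = 2 * twinPrimeConst :=
    tendsto_nhds_unique hC (hasBatemanHornConst_twinSystem tendsto_twinPrimeConstPartial_holds)
  convert hQ using 2 with x x
  · rw [polyPrimeCount_twinSystem]
  · have hdeg : ((X : ℤ[X]) + 2).natDegree = 1 := by simpa using natDegree_X_add_C (2 : ℤ)
    simp [twinSystem, hCeq, hdeg]

/-- **S4a for the single system `(X, X + 2)` proves the twin prime conjecture**
(`Literature.NumberTheory.Sieve.TwinPrimeConjecture`: beyond every `n` a prime `p` with `p + 2` prime),
from `π₂(x) ∼ 2C₂x/(log x)² → ∞` (`C₂ > 0`: `twinPrimeConst_pos_holds`). [folklore] -/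
theorem twinPrimeConjecture_of_core_twin
    (hCore : ∀ θ δ : ℝ, 0 < θ → θ < 1 → 0 < δ → δ < θ →
      (fun x : ℕ => ∑ n ∈ Finset.Icc 1 x,
        ∑ e ∈ Fintype.piFinset (fun i => (((twinSystem i).eval (n : ℤ)).toNat).divisors),
          if (x : ℝ) ^ (1 + θ) < ∏ i, ((((twinSystem i).eval (n : ℤ)).toNat / e i : ℕ) : ℝ) ∧
              ∏ i, (e i : ℝ) ≤ (x : ℝ) ^ (1 - δ) then
            ∏ i, ((ArithmeticFunction.moebius (((twinSystem i).eval (n : ℤ)).toNat / e i) : ℝ) *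
              Real.log ((((twinSystem i).eval (n : ℤ)).toNat / e i : ℕ) : ℝ)) else 0)
        =o[atTop] fun x : ℕ => (x : ℝ)) :
    TwinPrimeConjecture := by
  have hC2 : 0 < twinPrimeConst := twinPrimeConst_pos_holds
  refine twinPrimeConjecture_of_tendsto
    ((twinPrimeCount_isEquivalent_of_core_twin hCore).symm.tendsto_atTop ?_)
  have := tendsto_natCast_div_log_sq_atTop.const_mul_atTop (mul_pos two_pos hC2)
  simpa [mul_div_assoc] using this

/-- **HEADLINE — the registered stub `stub_large_core` (S4a of crux stmt-Parity-0870, signature verbatim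
as the hypothesis) proves the twin prime conjecture.**  Hence `stub_large_core` is crux-sized (indeed
summit-in-kind on the twin slice): any proof of it is a proof of `π₂(x) ∼ 2C₂x/(log x)²`.  This is the
kernel-checked content of the line leads' verdict `promote-stub: stub_large_core` (REPORT-c3, -c5, -c6, -c7
in `Cruxes/PolyMobiusTail/Lines/`). [folklore] -/
theorem twinPrimeConjecture_of_stub_large_core
    (hS4a : ∀ (k : ℕ) (f : Fin k → ℤ[X]), IsBatemanHornSystem f → ∀ θ δ : ℝ,
      0 < θ → θ < 1 → 0 < δ → δ < θ →
      (fun x : ℕ => ∑ n ∈ Finset.Icc 1 x,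
        ∑ e ∈ Fintype.piFinset (fun i => (((f i).eval (n : ℤ)).toNat).divisors),
          if (x : ℝ) ^ (1 + θ) < ∏ i, ((((f i).eval (n : ℤ)).toNat / e i : ℕ) : ℝ) ∧
              ∏ i, (e i : ℝ) ≤ (x : ℝ) ^ (1 - δ) then
            ∏ i, ((ArithmeticFunction.moebius (((f i).eval (n : ℤ)).toNat / e i) : ℝ) *
              Real.log ((((f i).eval (n : ℤ)).toNat / e i : ℕ) : ℝ)) else 0)
        =o[atTop] fun x : ℕ => (x : ℝ)) :
    TwinPrimeConjecture :=
  twinPrimeConjecture_of_core_twin (hS4a 2 twinSystem isBatemanHornSystem_twinSystem)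

end CoreStrength

end Summit.Parity.BatemanHorn.Theorems.PolyMobiusTail.EtaFreeWindow
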